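/-
Copyright (c) 2026 the pub-hodgecm-mathlib formalisation cell (harness21).  Prover seat hodgecm-mathlib-K2Liu-p01 (g8), Track B «K2-LIT»,
#184♮ = hLiu418 = `stmt-HodgeConjecture-24832`; #42S organ S1 ROAD W, F7 LAST-FILE phase chain (SPEC-F7-PhaseChain e96aa88172f3bbd5 §3 (Φ4)(Φ5)(Φ7)).
-/
import Summits.HodgeConjecture.HodgeConjecture.Theorems.K2LiuSiegelPairingTraceForm   -- ★ (i-b) `toLocalRing_d_mul_im_two_mul_trace`, `conjLocal_trace_herm_mul_herm`, `herm_delta_smul_gramS_mul`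
import HarnessLib

/-!
# Crux `HLiu418`, #42S-S1 ROAD W, phase chain (Φ4)(Φ5)(Φ7): `ι(d·½⟨x, c_t x⟩) = tr(H_t·G)`, additivity in `t`, and `t ↦ H_t` is ONTO the hermitian matrices

Cell `hodgecm-mathlib`, crux item hLiu418 = `stmt-HodgeConjecture-24832` (helper lane `--supports … --as helper`, count-neutral).  THEOREMS ONLY (no `def`, no instance,
no notation, no named-fact hypothesis, no `sorry`).  GENERIC doubled local currency `(F, E, c, δ, d, v, n, T₀)` of ★ (i-b).

WHY (SPEC-F7-PhaseChain §1–§3).  The Rao phase of the witness profile is `halfForm c_t x = ½·⟨x, c_t x⟩` with, BY VALUE from ★ (T3a) (`dotProduct_cOfFix_…_eq_im_trace` + ★ κ-comp (K2)),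
`⟨x, c_t x⟩ = im_Q(2·tr(S·t·G))` (`S = 𝕋₀`, `G` the hermitian Gram of `κ x`).  ★ (i-b) turns `d·im_Q(2z)` into `δ̂z + σ(δ̂z)`; for skew `t` and hermitian `G` the trace `tr(H_t G)`,
`H_t := δ̂•(S t)` (hermitian, ★ `herm_delta_smul_gramS_mul`), is `σ`-fixed, so:
* **(Φ4) `toLocalRing_d_mul_half_pairing`** — `ι(d·(⅟2·y)) = tr(H_t·G)` whenever `y = im_Q(2·tr(S t G))`: NO factor `2` survives (boxes need no dyadic shift);
* **(Φ5) `im_two_mul_trace_add`** — `y_{t+t′} = y_t + y_{t′}` (so `e(t+t′,x) = e(t,x)e(t′,x)`, ★ (T1)'s `hadd`);  `delta_smul_gramS_mul_add` (`H_{t+t′} = H_t + H_{t′}`; skew sums: ★ F3e `K2LiuUnipDeltaLocalCoordinates.skew_add`);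
* **(Φ7) `skew_of_herm`, `delta_smul_gramS_mul_of_herm`** — every hermitian `H` is `H_t` for the skew `t := S⁻¹(δ̂⁻¹H)` (converse of ★ `herm_delta_smul_gramS_mul`), so
  «`∀ t ∈ Skew ⊓ BOX_m`» ranges over ALL of `ϖ^{c₀−m}Herm_n(𝒪_E)` in the duality (dual) of the memo.
[GelbartRogawski1991, §3.1 p. 454] [Shimura1997, §13.2] [HarrisKudlaSweet1996, §1 (1.11)] [Kudla1994, §3].
HONEST LABEL.  Count-neutral helper; `HC_CM` is proved only modulo the 7 printed citations (2 remaining named inputs: hLiu418 = `stmt-HodgeConjecture-24832`,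
h413 = `stmt-HodgeConjecture-24833`) until rung 0 closes.

## References
* [GelbartRogawski1991] S. Gelbart, J. Rogawski, *L-functions and Fourier–Jacobi coefficients for U(3)*, Invent. Math. 105 (1991), §3.1.
* [Shimura1997] G. Shimura, *Euler Products and Eisenstein Series*, CBMS 93 (1997), §13.2.
* [HarrisKudlaSweet1996] M. Harris, S. S. Kudla, W. J. Sweet, J. Amer. Math. Soc. 9 (1996), §1 (1.11).
* [Kudla1994] S. S. Kudla, Israel J. Math. 87 (1994), §3.
-/

set_option autoImplicit false
set_option linter.dupNamespace false -- the mandated namespace repeats `HodgeConjecture.HodgeConjecture`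

noncomputable section

open NumberField IsDedekindDomain Matrix
open Literature.NumberTheory.Automorphic Literature.NumberTheory.Automorphic.UnitaryGroup
open Literature.NumberTheory.Automorphic.UnitaryGroup.QuadraticCoordinates
open Literature.NumberTheory.GelbartRogawski1991.UnitaryDualPair Literature.NumberTheory.GelbartRogawski1991.UnitaryDualPair.LocalSplitting

namespace Summit.HodgeConjecture.HodgeConjecture.Cruxes.HLiu418.K2LiuWitnessPhaseTrace

open K2LiuSiegelPairingTraceForm

variable (F : Type) [Field F] [NumberField F] (E : Type) [Field E] [NumberField E] [Algebra F E]
  [Algebra.IsQuadraticExtension F E] (c : E ≃ₐ[F] E)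
  {δ : E} (hcδ : c δ = -δ) (hδ : δ ≠ 0) {d : F} (hd : δ * δ = algebraMap F E d)
  (v : HeightOneSpectrum (𝓞 F)) (n : ℕ) {T₀ : Matrix (Fin n) (Fin n) F} (hT₀ : T₀.IsSymm) (hT₀d : IsUnit T₀.det)

/-! ## (Φ4) The half pairing is the hermitian trace -/

include hcδ hd hT₀ in
/-- **(Φ4) `ι(d · ½y) = tr(H_t · G)`** for `y = im_Q(2·tr(S t G))` (★ (T3a)'s pairing value), skew `t`, hermitian `G`: the Rao phase `½⟨x, c_t x⟩`, multiplied by `d`, IS the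
`σ`-fixed trace `tr(H_t G)` — no factor `2` survives. [cite: GelbartRogawski1991, §3.1 p. 454] [cite: Shimura1997, §13.2] -/
theorem toLocalRing_d_mul_half_pairing [Invertible (2 : v.adicCompletion F)] (t : Matrix (Fin n) (Fin n) (LocalRing E v))
    (ht : (t.map (conjLocal E c v))ᵀ * gramS F E v n T₀ + gramS F E v n T₀ * t = 0) {G : Matrix (Fin n) (Fin n) (LocalRing E v)}
    (hG : (G.map (conjLocal E c v))ᵀ = G) {y : v.adicCompletion F}
    (hy : y = im (quadraticLocalEquiv E v c hcδ hδ).toLinearEquiv.toAddEquiv (2 * Matrix.trace (gramS F E v n T₀ * t * G))) :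
    toLocalRing E v ((d : v.adicCompletion F) * (⅟(2 : v.adicCompletion F) * y)) =
      Matrix.trace ((algebraMap E (LocalRing E v) δ • (gramS F E v n T₀ * t)) * G) := by
  have h := toLocalRing_d_mul_im_two_mul_trace F E c hcδ hδ hd v n (gramS F E v n T₀) t G
  rw [conjLocal_trace_herm_mul_herm F E c hcδ v n hT₀ t ht hG, ← two_mul, ← hy] at h
  -- `ι(d·(⅟2·y)) = ι(⅟2)·ι(d·y) = ι(⅟2)·2·tr = tr`
  have e : (d : v.adicCompletion F) * (⅟(2 : v.adicCompletion F) * y) = ⅟(2 : v.adicCompletion F) * ((d : v.adicCompletion F) * y) := by ring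
  rw [e, map_mul, h, ← mul_assoc, ← map_ofNat (toLocalRing E v) 2, ← map_mul, invOf_mul_self, map_one, one_mul]

/-! ## (Φ5) Additivity in `t` -/

/-- **(Φ5)** the pairing value is additive in `t`: `im_Q(2·tr(S(t+t′)G)) = im_Q(2·tr(S t G)) + im_Q(2·tr(S t′ G))` (so `e(t+t′,x) = e(t,x)·e(t′,x)`, ★ (T1)'s `hadd`).
[cite: Kudla1994, §3] -/
theorem im_two_mul_trace_add (S t t' G : Matrix (Fin n) (Fin n) (LocalRing E v)) :
    im (quadraticLocalEquiv E v c hcδ hδ).toLinearEquiv.toAddEquiv (2 * Matrix.trace (S * (t + t') * G)) =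
      im (quadraticLocalEquiv E v c hcδ hδ).toLinearEquiv.toAddEquiv (2 * Matrix.trace (S * t * G)) +
        im (quadraticLocalEquiv E v c hcδ hδ).toLinearEquiv.toAddEquiv (2 * Matrix.trace (S * t' * G)) := by
  rw [Matrix.mul_add, Matrix.add_mul, trace_add, mul_add, map_add]

omit [Algebra.IsQuadraticExtension F E] in
/-- `H_{t+t′} = H_t + H_{t′}`. [folklore] -/
theorem delta_smul_gramS_mul_add (t t' : Matrix (Fin n) (Fin n) (LocalRing E v)) :
    algebraMap E (LocalRing E v) δ • (gramS F E v n T₀ * (t + t')) = algebraMap E (LocalRing E v) δ • (gramS F E v n T₀ * t) + algebraMap E (LocalRing E v) δ • (gramS F E v n T₀ * t') := by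
  rw [Matrix.mul_add, smul_add]

/-! ## (Φ7) Every hermitian matrix is `H_t` for a skew `t` -/

omit [Algebra.IsQuadraticExtension F E] in
/-- `σ`-image of a scalar multiple of a matrix. [folklore] -/
theorem map_smul_conj (a : LocalRing E v) (M : Matrix (Fin n) (Fin n) (LocalRing E v)) : (a • M).map (conjLocal E c v) = conjLocal E c v a • M.map (conjLocal E c v) :=
  Matrix.ext fun i j => by simp only [map_apply, Matrix.smul_apply, smul_eq_mul, map_mul]

omit [Algebra.IsQuadraticExtension F E] in
include hcδ hδ hT₀ hT₀d in
/-- **(Φ7a) the candidate `t := S⁻¹·(δ̂⁻¹•H)` is SKEW for hermitian `H`.** [cite: HarrisKudlaSweet1996, §1 (1.11)] [cite: Shimura1997, §13.2] -/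
theorem skew_of_herm {H : Matrix (Fin n) (Fin n) (LocalRing E v)} (hH : (H.map (conjLocal E c v))ᵀ = H) :
    (((gramS F E v n T₀)⁻¹ * (Ring.inverse (algebraMap E (LocalRing E v) δ) • H)).map (conjLocal E c v))ᵀ * gramS F E v n T₀ +
        gramS F E v n T₀ * ((gramS F E v n T₀)⁻¹ * (Ring.inverse (algebraMap E (LocalRing E v) δ) • H)) = 0 := by
  have hS := isUnit_det_gramS' F E v n hT₀d
  have hδu : IsUnit (algebraMap E (LocalRing E v) δ) := (IsUnit.mk0 δ hδ).map _
  set a := Ring.inverse (algebraMap E (LocalRing E v) δ) with ha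
  -- `σ a = −a`
  have hσa : conjLocal E c v a = -a := by
    have h1 : conjLocal E c v (algebraMap E (LocalRing E v) δ) = -algebraMap E (LocalRing E v) δ := by rw [conjLocal_algebraMap, hcδ, map_neg]
    have hinv : a * algebraMap E (LocalRing E v) δ = 1 := Ring.inverse_mul_cancel _ hδu
    -- `σ a · σ δ̂ = 1`, `σ δ̂ = −δ̂` ⇒ `σ a = −a`
    have h2 : conjLocal E c v a * (-algebraMap E (LocalRing E v) δ) = 1 := by rw [← h1, ← map_mul, hinv, map_one]
    have h3 : (-conjLocal E c v a) * algebraMap E (LocalRing E v) δ = 1 := by rw [neg_mul, ← mul_neg]; exact h2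
    have h4 : -conjLocal E c v a = a := by
      calc -conjLocal E c v a = (-conjLocal E c v a) * (algebraMap E (LocalRing E v) δ * a) := by rw [Ring.mul_inverse_cancel _ hδu, mul_one]
        _ = a := by rw [← mul_assoc, h3, one_mul]
    exact neg_eq_iff_eq_neg.1 h4
  -- `σ(S⁻¹) = S⁻¹`, `(S⁻¹)ᵀ = S⁻¹`
  -- `σ(S⁻¹) = S⁻¹` (uniqueness of the inverse; `σ(S) = S`), `(S⁻¹)ᵀ = S⁻¹`
  have hSσ : ((gramS F E v n T₀)⁻¹).map (conjLocal E c v) = (gramS F E v n T₀)⁻¹ := by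
    symm
    refine Matrix.inv_eq_right_inv ?_
    have h := congrArg (fun M : Matrix (Fin n) (Fin n) (LocalRing E v) => M.map (conjLocal E c v)) (mul_nonsing_inv _ hS)
    simpa only [Matrix.map_mul, gramS_map_conj F E c v n, Matrix.map_one (conjLocal E c v) (map_zero _) (map_one _)] using h
  have hSt : ((gramS F E v n T₀)⁻¹)ᵀ = (gramS F E v n T₀)⁻¹ := by rw [transpose_nonsing_inv, gramS_transpose F E v n hT₀]
  have e1 : (((gramS F E v n T₀)⁻¹ * (a • H)).map (conjLocal E c v))ᵀ = ((-a) • H) * (gramS F E v n T₀)⁻¹ := by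
    rw [Matrix.map_mul, map_smul_conj, hSσ, hσa, transpose_mul, transpose_smul, hH, hSt]
  rw [e1, Matrix.mul_assoc ((-a) • H), nonsing_inv_mul _ hS, Matrix.mul_one, ← Matrix.mul_assoc (gramS F E v n T₀), mul_nonsing_inv _ hS,
    Matrix.one_mul, neg_smul, neg_add_cancel]

omit [Algebra.IsQuadraticExtension F E] in
include hδ hT₀d in
/-- **(Φ7b) … and `H_t = H`** for that `t`: `δ̂ • (S · (S⁻¹(δ̂⁻¹•H))) = H`. [cite: Shimura1997, §13.2] -/
theorem delta_smul_gramS_mul_of_herm (H : Matrix (Fin n) (Fin n) (LocalRing E v)) :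
    algebraMap E (LocalRing E v) δ • (gramS F E v n T₀ * ((gramS F E v n T₀)⁻¹ * (Ring.inverse (algebraMap E (LocalRing E v) δ) • H))) = H := by
  have hS := isUnit_det_gramS' F E v n hT₀d
  have hδu : IsUnit (algebraMap E (LocalRing E v) δ) := (IsUnit.mk0 δ hδ).map _
  rw [← Matrix.mul_assoc, mul_nonsing_inv _ hS, Matrix.one_mul, smul_smul, Ring.mul_inverse_cancel _ hδu, one_smul]

omit [Algebra.IsQuadraticExtension F E] in
include hcδ hδ hT₀ hT₀d in
/-- **(Φ7) ONTO**: a property holds for `H_t = δ̂•(S t)` for all skew `t` iff it holds for all hermitian `H`. [cite: Shimura1997, §13.2] [cite: HarrisKudlaSweet1996, §1 (1.11)] -/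
theorem forall_skew_iff_forall_herm (P : Matrix (Fin n) (Fin n) (LocalRing E v) → Prop) :
    (∀ t : Matrix (Fin n) (Fin n) (LocalRing E v), (t.map (conjLocal E c v))ᵀ * gramS F E v n T₀ + gramS F E v n T₀ * t = 0 →
        P (algebraMap E (LocalRing E v) δ • (gramS F E v n T₀ * t))) ↔
      ∀ H : Matrix (Fin n) (Fin n) (LocalRing E v), (H.map (conjLocal E c v))ᵀ = H → P H := by
  constructor
  · intro h H hH
    have := h _ (skew_of_herm F E c hcδ hδ v n hT₀ hT₀d hH)
    rwa [delta_smul_gramS_mul_of_herm F E hδ v n hT₀d H] at this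
  · intro h t ht
    exact h _ (herm_delta_smul_gramS_mul F E c hcδ v n hT₀ t ht)

end Summit.HodgeConjecture.HodgeConjecture.Cruxes.HLiu418.K2LiuWitnessPhaseTrace

end
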